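import Mathlib.Analysis.MeanInequalitiesPow
import Mathlib.Analysis.SpecialFunctions.Pow.NNReal
import Summits.CriticalPhenomena.PercolationContinuityZ3.Theorems.PercNearOneGluingNoHeavyLowerTailSunflowerLSMGraded

/-!
# `NoHeavyLowerTail` (crux stmt-CriticalPhenomena-4575), abstract sunflower cubic: TOOLS FOR THE COVER PROPERTY
# (floor lifting, Hölder for block expectations, level counting)

Support file (seat `prim-ineq-prove-1` gen 36; `--supports stmt-CriticalPhenomena-4575`).  No `sorry`, no named facts.
Memo: run/shared/lean/prim/prim-ineq-prove-1/FINDING-COVER-prove1-g36.md §2.  Used by `…SunflowerCoverGraded`.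
* `affine_rpow_le`, **`prod_affine_le_pow`** — floors lift for free: `x_k ∈ [h,1]`, `∏ x_k ≤ h^t` ⟹
  `∏ (c + (1−c) x_k) ≤ (c + (1−c) h)^t` (Jensen for the two-point law: `c + (1−c) h^s ≤ (c + (1−c) h)^s`, `s ∈ (0,1]`).
* `BEx_sum`, `BEx_smul`, **`BEx_prod_le`** — Hölder's inequality for block expectations in AM–GM form:
  `BEx (∏_{l<N} Y_l) ≤ ∏_l BEx (Y_l ^ N) ^ (1/N)` for nonnegative `Y_l`.
* `card_filter_le_val`, `pow_eq_prod_ite` — `q^k = ∏_{l<N} q^{[l<k]}` (levels), and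
  `le_q_pow_floor` — `x ≤ (c^{1/N})^{⌊N·log x/log c⌋}` (integer ranks, as in `…SunflowerLSMGraded`).
-/

noncomputable section

namespace Summit.CriticalPhenomena.PercolationContinuityZ3.Theorems.SunflowerPartition

namespace SafeCalc

open MeasureTheory Finset Filter Topology
open Literature.Probability.LatticeModels Literature.Probability.Percolation
open TwoGenCore (wmiss)

variable {ι : Type*} [DecidableEq ι] (p : ι → unitInterval) (a : Finset ι)

/-! ## Lifting the floor -/

/-- Jensen for the two-point law: `c + (1 − c) h^s ≤ (c + (1 − c) h)^s` for `s ∈ (0,1]`. [this work] -/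
theorem affine_rpow_le {c h s : ℝ} (hc : 0 ≤ c) (hc1 : c ≤ 1) (hh : 0 ≤ h) (hs : 0 < s) (hs1 : s ≤ 1) :
    c + (1 - c) * h ^ s ≤ (c + (1 - c) * h) ^ s := by
  have hp : 1 ≤ 1 / s := one_le_one_div hs hs1
  have key := Real.arith_mean_le_rpow_mean (univ : Finset (Fin 2)) ![c, 1 - c] ![1, h ^ s]
    (fun i _ => by fin_cases i <;> simp <;> linarith) (by simp [Fin.sum_univ_two]) (fun i _ => by
      fin_cases i
      · simp
      · simpa using Real.rpow_nonneg hh s) hp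
  simp only [Fin.sum_univ_two, Matrix.cons_val_zero, Matrix.cons_val_one] at key
  have h1 : (1 : ℝ) ^ (1 / s) = 1 := Real.one_rpow _
  have h2 : (h ^ s) ^ (1 / s) = h := by
    rw [← Real.rpow_mul hh, mul_one_div_cancel hs.ne', Real.rpow_one]
  have h3 : (1 : ℝ) / (1 / s) = s := one_div_one_div s
  rw [h1, h2, h3] at key
  simpa using key

/-- **Lifting the floor.**  If `x_k ∈ [h,1]` (`0 < h ≤ 1`) and `∏ x_k ≤ h^t` then `∏ (c + (1−c) x_k) ≤ (c + (1−c)h)^t` for every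
`c ∈ [0,1]`. [this work] -/
theorem prod_affine_le_pow {κ : Type*} [Fintype κ] {x : κ → ℝ} {h c : ℝ} {t : ℕ} (hh : 0 < h) (hh1 : h ≤ 1)
    (hc : 0 ≤ c) (hc1 : c ≤ 1) (hx : ∀ k, h ≤ x k) (hx1 : ∀ k, x k ≤ 1) (hprod : ∏ k, x k ≤ h ^ t) :
    ∏ k, (c + (1 - c) * x k) ≤ (c + (1 - c) * h) ^ t := by
  rcases eq_or_lt_of_le hh1 with rfl | hh1'
  · have hx' : ∀ k, x k = 1 := fun k => le_antisymm (hx1 k) (hx k)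
    simp only [hx', mul_one, add_sub_cancel, prod_const_one, one_pow, le_refl]
  set F0 := c + (1 - c) * h with hF0
  have hF0pos : 0 < F0 := by rw [hF0]; nlinarith
  have hF01 : F0 ≤ 1 := by rw [hF0]; nlinarith
  have hxpos : ∀ k, 0 < x k := fun k => hh.trans_le (hx k)
  have hs0 : ∀ k, 0 ≤ rho h (x k) := fun k => rho_nonneg hh hh1' (hxpos k) (hx1 k)
  have hs1 : ∀ k, rho h (x k) ≤ 1 := fun k => rho_le_one hh hh1' (hx k)
  have hxs : ∀ k, h ^ rho h (x k) = x k := fun k => rpow_rho hh hh1' (hxpos k)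
  have hfac : ∀ k, c + (1 - c) * x k ≤ F0 ^ rho h (x k) := by
    intro k
    rcases eq_or_lt_of_le (hs0 k) with h0 | hpos
    · have hx1' : x k = 1 := by rw [← hxs k, ← h0, Real.rpow_zero]
      rw [← h0, Real.rpow_zero, hx1']; linarith
    · conv_lhs => rw [← hxs k]
      exact affine_rpow_le hc hc1 hh.le hpos (hs1 k)
  have hsum : (t : ℝ) ≤ ∑ k, rho h (x k) := by
    have hlog : ∑ k, Real.log (x k) ≤ (t : ℝ) * Real.log h := by
      rw [← Real.log_prod (fun k _ => (hxpos k).ne'), ← Real.log_pow]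
      exact Real.log_le_log (prod_pos fun k _ => hxpos k) hprod
    have : ∑ k, rho h (x k) = (∑ k, Real.log (x k)) / Real.log h := by unfold rho; rw [sum_div]
    rw [this, le_div_iff_of_neg (log_c_neg hh hh1')]
    linarith
  calc ∏ k, (c + (1 - c) * x k) ≤ ∏ k, F0 ^ rho h (x k) :=
        prod_le_prod (fun k _ => by nlinarith [hx k]) (fun k _ => hfac k)
    _ = F0 ^ ∑ k, rho h (x k) := (Real.rpow_sum_of_pos hF0pos _ _).symm
    _ ≤ F0 ^ (t : ℝ) := Real.rpow_le_rpow_of_exponent_ge hF0pos hF01 hsum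
    _ = F0 ^ t := Real.rpow_natCast F0 t

/-! ## Hölder's inequality for block expectations -/

/-- `BEx` of a finite sum. [this work] -/
theorem BEx_sum {β : Type*} (s : Finset β) (F : β → Finset ι → ℝ) :
    BEx p a (fun T => ∑ b ∈ s, F b T) = ∑ b ∈ s, BEx p a (F b) := by
  unfold BEx
  rw [Finset.sum_comm]
  exact sum_congr rfl fun T _ => mul_sum _ _ _

/-- `BEx` of a scalar multiple. [this work] -/
theorem BEx_smul (α : ℝ) (F : Finset ι → ℝ) : BEx p a (fun T => α * F T) = α * BEx p a F := by
  have h := BEx_affine p a 0 α F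
  simpa using h

/-- **Hölder's inequality** for block expectations, in AM–GM form: for nonnegative `Y_l` (`l < N`, `N ≥ 1`) with
`BEx (Y_l ^ N) > 0`, `BEx (∏_l Y_l) ≤ ∏_l BEx (Y_l ^ N) ^ (1/N)`. [this work] -/
theorem BEx_prod_le {N : ℕ} (hN : N ≠ 0) (Y : Fin N → Finset ι → ℝ) (hY : ∀ l T, T ⊆ a → 0 ≤ Y l T)
    (hpos : ∀ l, 0 < BEx p a (fun T => Y l T ^ N)) :
    BEx p a (fun T => ∏ l, Y l T) ≤ ∏ l, BEx p a (fun T => Y l T ^ N) ^ ((N : ℝ)⁻¹) := by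
  set A : Fin N → ℝ := fun l => BEx p a (fun T => Y l T ^ N) with hA
  have hApos : ∀ l, 0 < A l := hpos
  set P : ℝ := ∏ l, A l ^ ((N : ℝ)⁻¹) with hP
  have hPpos : 0 < P := prod_pos fun l _ => Real.rpow_pos_of_pos (hApos l) _
  have hNpos : (0 : ℝ) < N := by exact_mod_cast Nat.pos_of_ne_zero hN
  -- pointwise AM–GM after normalisation
  have hpt : ∀ T, T ⊆ a → ∏ l, Y l T ≤ P * ∑ l, ((N : ℝ)⁻¹ / A l) * Y l T ^ N := by
    intro T hT
    have hw : ∀ l ∈ (univ : Finset (Fin N)), 0 ≤ (fun _ : Fin N => (N : ℝ)⁻¹) l := fun l _ => by positivity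
    have hw' : ∑ l ∈ (univ : Finset (Fin N)), (fun _ : Fin N => (N : ℝ)⁻¹) l = 1 := by
      rw [sum_const, card_univ, Fintype.card_fin, nsmul_eq_mul, mul_inv_cancel₀ hNpos.ne']
    have hz : ∀ l ∈ (univ : Finset (Fin N)), 0 ≤ (fun l => Y l T ^ N / A l) l :=
      fun l _ => div_nonneg (pow_nonneg (hY l T hT) N) (hApos l).le
    have amgm := Real.geom_mean_le_arith_mean_weighted univ (fun _ => (N : ℝ)⁻¹) (fun l => Y l T ^ N / A l) hw hw' hz
    have hlhs : ∏ l, (Y l T ^ N / A l) ^ (N : ℝ)⁻¹ = (∏ l, Y l T) / P := by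
      rw [hP, ← prod_div_distrib]
      refine prod_congr rfl fun l _ => ?_
      rw [Real.div_rpow (pow_nonneg (hY l T hT) N) (hApos l).le, Real.pow_rpow_inv_natCast (hY l T hT) hN]
    have hrhs : ∑ l, (N : ℝ)⁻¹ * (Y l T ^ N / A l) = ∑ l, ((N : ℝ)⁻¹ / A l) * Y l T ^ N :=
      sum_congr rfl fun l _ => by ring
    have amgm' : ∏ l, (Y l T ^ N / A l) ^ (N : ℝ)⁻¹ ≤ ∑ l, (N : ℝ)⁻¹ * (Y l T ^ N / A l) := amgm
    rw [hlhs, hrhs, div_le_iff₀ hPpos] at amgm'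
    linarith [amgm']
  calc BEx p a (fun T => ∏ l, Y l T) ≤ BEx p a (fun T => P * ∑ l, ((N : ℝ)⁻¹ / A l) * Y l T ^ N) := BEx_mono p a hpt
    _ = P * ∑ l, ((N : ℝ)⁻¹ / A l) * BEx p a (fun T => Y l T ^ N) := by
        rw [BEx_smul, BEx_sum]
        congr 1
        exact sum_congr rfl fun l _ => BEx_smul p a _ _
    _ = P * ∑ l : Fin N, (N : ℝ)⁻¹ := by
        congr 1
        exact sum_congr rfl fun l _ => by
          change (N : ℝ)⁻¹ / A l * A l = (N : ℝ)⁻¹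
          rw [div_mul_cancel₀ _ (hApos l).ne']
    _ = P := by rw [sum_const, card_univ, Fintype.card_fin, nsmul_eq_mul, mul_inv_cancel₀ hNpos.ne', mul_one]

/-! ## Counting levels -/

/-- `#{l < N : k ≤ l} = N − k`. [this work] -/
theorem card_filter_le_val {N k : ℕ} : (univ.filter fun l : Fin N => k ≤ (l : ℕ)).card = N - k := by
  have h : (univ.filter fun l : Fin N => k ≤ (l : ℕ)).map Fin.valEmbedding = Finset.Ico k N := by
    ext x
    rw [Finset.mem_map, Finset.mem_Ico]
    constructor
    · rintro ⟨l, hl, rfl⟩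
      rw [Finset.mem_filter] at hl
      exact ⟨hl.2, l.2⟩
    · rintro ⟨h1, h2⟩
      exact ⟨⟨x, h2⟩, by rw [Finset.mem_filter]; exact ⟨Finset.mem_univ _, h1⟩, rfl⟩
  rw [← Finset.card_map Fin.valEmbedding, h, Nat.card_Ico]

/-- `q ^ k = ∏_{l < N} (if l < k then q else 1)` for `k ≤ N` (the count `#{l < N : l < k} = k` is folklore, cf.
`Literature.Computability.Cryptography.card_filter_val_lt`). [this work] -/
theorem pow_eq_prod_ite {N k : ℕ} (hk : k ≤ N) (q : ℝ) :
    q ^ k = ∏ l : Fin N, (if (l : ℕ) < k then q else 1) := by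
  have hcard : (univ.filter fun l : Fin N => (l : ℕ) < k).card = k := by
    have h : (univ.filter fun l : Fin N => (l : ℕ) < k).map Fin.valEmbedding = Finset.range k := by
      ext x
      rw [Finset.mem_map, Finset.mem_range]
      constructor
      · rintro ⟨l, hl, rfl⟩
        rw [Finset.mem_filter] at hl
        exact hl.2
      · intro hx
        exact ⟨⟨x, lt_of_lt_of_le hx hk⟩, by rw [Finset.mem_filter]; exact ⟨Finset.mem_univ _, hx⟩, rfl⟩
    rw [← Finset.card_map Fin.valEmbedding, h, Finset.card_range]
  rw [prod_ite, prod_const_one, mul_one, prod_const, hcard]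

/-! ## Rounding exponents -/

/-- `x ≤ (c^{1/N})^{⌊N ρ(x)⌋}` for `x ∈ (0,1]`: rounding the exponent down only increases the power. [this work] -/
theorem le_q_pow_floor {c : ℝ} (hc : 0 < c) (hc1 : c < 1) {N : ℕ} (hN : 0 < N) {x : ℝ} (hx : 0 < x) (hx1 : x ≤ 1) :
    x ≤ (c ^ (1 / (N : ℝ))) ^ ⌊(N : ℝ) * rho c x⌋₊ := by
  have hNr : (0 : ℝ) < N := by exact_mod_cast hN
  rw [← Real.rpow_natCast, ← Real.rpow_mul hc.le]
  conv_lhs => rw [← rpow_rho hc hc1 hx]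
  refine Real.rpow_le_rpow_of_exponent_ge hc hc1.le ?_
  rw [one_div_mul_eq_div, div_le_iff₀ hNr]
  have hr : 0 ≤ (N : ℝ) * rho c x := mul_nonneg hNr.le (rho_nonneg hc hc1 hx hx1)
  exact (Nat.floor_le hr).trans (le_of_eq (mul_comm _ _))

end SafeCalc

end Summit.CriticalPhenomena.PercolationContinuityZ3.Theorems.SunflowerPartition
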